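import Mathlib.Analysis.SpecialFunctions.Trigonometric.Basic
import Mathlib.Data.Finsupp.Basic
import Mathlib.Algebra.BigOperators.Ring.Finset
import Mathlib.Algebra.Order.BigOperators.Ring.Finset
import HarnessLib

/-!
# The Fröhlich–Spencer expansion into 1-ensembles (Fröhlich–Spencer 1982, Lemma 2)

Support file for the Coulomb-gas / sine-Gordon analysis of abelian lattice models at weak
coupling — the proof programme of the named fact
`Literature.MathematicalPhysics.QuantumFieldTheory.FrohlichSpencerU1PerimeterLawD4` (the `U(1)₄`
perimeter law, Fröhlich–Spencer 1982 §2) and of its corollary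
`Literature.Barriers.QuantumFields.AbelianDeconfinementD4`. Everything is PROVED; no named fact
is introduced (D-0026).

After the duality transformation and the Poisson summation formula (FS82 §2.4–2.6, (2.37)–(2.40)),
the dual Gibbs factor of the `U(1)` theory in a finite region is a positive superposition, over
assignments of frequencies `q_b ≠ 0` to the links `b` of the region, of the trigonometric products
`∏_b (1 + z_b cos(q_b α_b))` against a Gaussian measure. **Lemma 2** of FS82 (p. 424; "a simple
special case of Lemma 2.2 in [Fröhlich–Spencer 1981]") rewrites each such product as a CONVEX
combination of products over *1-ensembles*:

> `∏_{xy ⊂ Λ*} (1 + z_{q_{xy}} cos(q_{xy} α_{xy})) = ∑_γ c_γ ∏_{ρ ∈ 𝒩_γ} [1 + K(ρ) cos(α(ρ))]`,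
> where `γ` ranges over some finite index set, each `𝒩_γ` is a 1-ensemble and
> i) `c_γ > 0`, for all `γ`;
> ii) `K(ρ) ≤ ∏_{xy ⊂ supp ρ} z_{|ρ_{xy}|} · 3^{N₁(supp ρ)}`, where `N₁(supp ρ)` is the number of
> links within distance `≤ 1` of the support of `ρ`.

Here (FS82 p. 424) a *current density* `ρ` is a finitely supported integer function on the links,
`α(ρ) = ∑_{xy} ρ_{xy} α_{xy}`, an *ensemble* is a family of current densities with pairwise
disjoint supports inside the region, and a *1-ensemble* is an ensemble any two members of which
have supports at Euclidean distance `> 1`. The printed proof (pp. 425–426) is the repeated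
application of the identity (2.42),

> `(1 + K₁ cos α(ρ₁))(1 + K₂ cos α(ρ₂)) = ⅓[1 + 3K₁ cos α(ρ₁)] + ⅓[1 + 3K₂ cos α(ρ₂)]`
> `  + ⅙[1 + 3K₁K₂ cos(α(ρ₁ - ρ₂))] + ⅙[1 + 3K₁K₂ cos(α(ρ₁ + ρ₂))]`,

to any two factors whose densities are within distance `1`, each product being expanded as a sum
of products, until every resulting family is a 1-ensemble (termination: every application lowers
the number of factors of the affected term by one); the activity of a density obtained after
`n(ρ)` applications is `3^{n(ρ)}` times the product of the original activities of its links
((2.45)), and "a minute of reflection shows that `n(ρ) ≤ N₁(supp ρ)`" (each application consumes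
a distinct factor supported within distance `1` of `supp ρ`).

We formalise exactly this, for an ABSTRACT set of links: a type `B` with a finite set `S` of
active links, and a symmetric relation `adj` on `B` playing the role of "Euclidean distance `≤ 1`"
(any symmetric relation will do; the geometry only enters the size of `N₁`). The output is a
finite list of terms `(c_γ, 𝒩_γ, K_γ)`:

* `phase ρ α = ∑_b ρ(b) α(b)` (the pairing `α(ρ)`), `ensembleProd 𝒩 K α = ∏_{ρ∈𝒩} (1 + K ρ cos(α(ρ)))`;
* `IsOneEnsemble adj 𝒩` (pairwise: supports disjoint and not adjacent), `nbhd adj S A`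
  (the links of `S` in `A` or adjacent to a link of `A`; its cardinality is `N₁(A)`);
* `cos_pair_identity` — the identity (2.42);
* `IsAdjConnected adj A` (connectedness of a set of links at distance `1`, with the union lemma);
* `exists_oneEnsemble_expansion` (**FS82 Lemma 2**): for `q_b ≠ 0` and `z_b ≥ 0` on `S` there is
  a finite list of terms with `c_γ > 0`, `∑_γ c_γ = 1`, every `𝒩_γ` a 1-ensemble of non-zero
  densities `ρ` supported in `S`, connected at distance `1` (the supports arise by merging adjacent
  supports — this is what bounds the hypercube `Ω_ρ` in FS82 (2.85)), with `|ρ_b| = |q_b|` on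
  `supp ρ`, activities
  `0 ≤ K_γ(ρ) ≤ 3^{N₁(supp ρ)} ∏_{b ∈ supp ρ} z_b`, and
  `∏_{b∈S} (1 + z_b cos(q_b α_b)) = ∑_γ c_γ ∏_{ρ∈𝒩_γ} (1 + K_γ(ρ) cos(α(ρ)))` for every field `α`.

The proof is the printed induction, run on the number of factors with the bookkeeping invariant
`ExpansionState` (each density `ρ` carries a set `W(ρ) ⊇ supp ρ` of consumed links within
distance `1` of `supp ρ`, the `W`'s pairwise disjoint, and `3·K(ρ) ≤ 3^{#W(ρ)} ∏_{supp ρ} z`).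
The normalisation `∑ c_γ = 1` (the weights `⅓, ⅓, ⅙, ⅙` of (2.42) sum to one) is recorded as well.

## References

* J. Fröhlich, T. Spencer, *Massless phases and symmetry restoration in abelian gauge theories
  and spin systems*, Comm. Math. Phys. 83 (1982) 411–454, §2.6, Lemma 2, (2.41)–(2.45), pp. 424–426.
  [FrohlichSpencerCMP1982]
* J. Fröhlich, T. Spencer, *The Kosterlitz–Thouless transition in two-dimensional abelian spin
  systems and the Coulomb gas*, Comm. Math. Phys. 81 (1981) 527–602, Lemma 2.2. [FrohlichSpencerKT1981]
-/

noncomputable section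

open Finset
open scoped BigOperators

namespace Literature.Probability.LatticeModels

namespace EnsembleExpansion

variable {B : Type*}

/-! ### Current densities, phases and factor products -/

/-- The phase `α(ρ) = ∑_b ρ(b) α(b)` of the current density `ρ` in the field `α`
(FS82 p. 424: `α(ρ) = ∑'_{xy} α_{xy} ρ_{xy}`). [cite: FrohlichSpencerCMP1982, §2.6 p. 424] -/
def phase (ρ : B →₀ ℤ) (α : B → ℝ) : ℝ := ρ.sum fun b n => (n : ℝ) * α b

/-- Additivity of the phase in the density. [folklore] -/
theorem phase_add (ρ ρ' : B →₀ ℤ) (α : B → ℝ) : phase (ρ + ρ') α = phase ρ α + phase ρ' α := by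
  unfold phase
  exact Finsupp.sum_add_index' (fun b => by simp) (fun b m n => by push_cast; ring)

/-- `α(-ρ) = -α(ρ)`. [folklore] -/
theorem phase_neg (ρ : B →₀ ℤ) (α : B → ℝ) : phase (-ρ) α = -phase ρ α := by
  have h := phase_add (-ρ) ρ α
  rw [neg_add_cancel] at h
  have h0 : phase (0 : B →₀ ℤ) α = 0 := by simp [phase]
  linarith

/-- `α(ρ - ρ') = α(ρ) - α(ρ')`. [folklore] -/
theorem phase_sub (ρ ρ' : B →₀ ℤ) (α : B → ℝ) : phase (ρ - ρ') α = phase ρ α - phase ρ' α := by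
  rw [sub_eq_add_neg, phase_add, phase_neg, sub_eq_add_neg]

/-- The phase of an elementary density `q·δ_b` is `q α_b`. [folklore] -/
@[simp] theorem phase_single (b : B) (q : ℤ) (α : B → ℝ) :
    phase (Finsupp.single b q) α = (q : ℝ) * α b := by
  unfold phase
  exact Finsupp.sum_single_index (by simp)

/-- The factor product `∏_{ρ ∈ 𝒩} (1 + K(ρ) cos α(ρ))` of a finite family of densities with
activities `K`. [cite: FrohlichSpencerCMP1982, (2.41)] -/
def ensembleProd (N : Finset (B →₀ ℤ)) (K : (B →₀ ℤ) → ℝ) (α : B → ℝ) : ℝ :=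
  ∏ ρ ∈ N, (1 + K ρ * Real.cos (phase ρ α))

/-- A term `(c_γ, 𝒩_γ, K_γ)` of the expansion: a weight, a finite family of current densities and
their activities. [cite: FrohlichSpencerCMP1982, (2.41)] -/
structure Term (B : Type*) where
  /-- the weight `c_γ` -/
  weight : ℝ
  /-- the family `𝒩_γ` -/
  family : Finset (B →₀ ℤ)
  /-- the activities `K_γ` (only the values on `family` matter) -/
  activity : (B →₀ ℤ) → ℝ

/-- The value `c_γ ∏_{ρ∈𝒩_γ} (1 + K_γ(ρ) cos α(ρ))` of a term at the field `α`. [folklore] -/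
def Term.eval (t : Term B) (α : B → ℝ) : ℝ := t.weight * ensembleProd t.family t.activity α

/-- Rescaling the weight of a term. [folklore] -/
def Term.scale (a : ℝ) (t : Term B) : Term B := ⟨a * t.weight, t.family, t.activity⟩

/-- Weight of a rescaled term. [folklore] -/
@[simp] theorem Term.scale_weight (a : ℝ) (t : Term B) : (t.scale a).weight = a * t.weight := rfl
/-- Family of a rescaled term. [folklore] -/
@[simp] theorem Term.scale_family (a : ℝ) (t : Term B) : (t.scale a).family = t.family := rfl
/-- Activities of a rescaled term. [folklore] -/
@[simp] theorem Term.scale_activity (a : ℝ) (t : Term B) : (t.scale a).activity = t.activity := rfl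

/-- Value of a rescaled term. [folklore] -/
theorem Term.eval_scale (a : ℝ) (t : Term B) (α : B → ℝ) :
    (t.scale a).eval α = a * t.eval α := by
  simp [Term.eval, Term.scale, mul_assoc]

/-- The total value `∑_γ c_γ ∏_{ρ∈𝒩_γ} (…)` of a list of terms. [folklore] -/
def evalSum (L : List (Term B)) (α : B → ℝ) : ℝ := (L.map fun t => t.eval α).sum

/-- The total weight `∑_γ c_γ` of a list of terms. [folklore] -/
def weightSum (L : List (Term B)) : ℝ := (L.map Term.weight).sum

/-- Value of the empty list. [folklore] -/
@[simp] theorem evalSum_nil (α : B → ℝ) : evalSum ([] : List (Term B)) α = 0 := rfl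
/-- Value of a cons. [folklore] -/
@[simp] theorem evalSum_cons (t : Term B) (L : List (Term B)) (α : B → ℝ) :
    evalSum (t :: L) α = t.eval α + evalSum L α := by simp [evalSum]
/-- Value of a concatenation. [folklore] -/
theorem evalSum_append (L L' : List (Term B)) (α : B → ℝ) :
    evalSum (L ++ L') α = evalSum L α + evalSum L' α := by simp [evalSum, List.sum_append]
/-- Value of a rescaled list. [folklore] -/
theorem evalSum_map_scale (a : ℝ) (L : List (Term B)) (α : B → ℝ) :
    evalSum (L.map (Term.scale a)) α = a * evalSum L α := by
  simp only [evalSum, List.map_map]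
  rw [← List.sum_map_mul_left]
  congr 1
  exact List.map_congr_left fun t _ => by simp [Function.comp, Term.eval_scale]

/-- Weight of the empty list. [folklore] -/
@[simp] theorem weightSum_nil : weightSum ([] : List (Term B)) = 0 := rfl
/-- Weight of a cons. [folklore] -/
@[simp] theorem weightSum_cons (t : Term B) (L : List (Term B)) :
    weightSum (t :: L) = t.weight + weightSum L := by simp [weightSum]
/-- Weight of a concatenation. [folklore] -/
theorem weightSum_append (L L' : List (Term B)) :
    weightSum (L ++ L') = weightSum L + weightSum L' := by simp [weightSum, List.sum_append]
/-- Weight of a rescaled list. [folklore] -/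
theorem weightSum_map_scale (a : ℝ) (L : List (Term B)) :
    weightSum (L.map (Term.scale a)) = a * weightSum L := by
  simp only [weightSum, List.map_map]
  rw [← List.sum_map_mul_left]
  congr 1

/-! ### Ensembles -/

/-- **1-ensembles** (FS82 p. 424) relative to the "distance `≤ 1`" relation `adj`: any two distinct
members of the family have disjoint supports no link of one being adjacent to a link of the other.
[cite: FrohlichSpencerCMP1982, §2.6 p. 424] -/
def IsOneEnsemble (adj : B → B → Prop) (N : Finset (B →₀ ℤ)) : Prop :=
  ∀ ρ ∈ N, ∀ ρ' ∈ N, ρ ≠ ρ' → ∀ a ∈ ρ.support, ∀ b ∈ ρ'.support, a ≠ b ∧ ¬ adj a b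

open Classical in
/-- The links of `S` within distance `1` of the set of links `A` (the links of `A` themselves
included): its cardinality is FS82's `N₁(A)`. [cite: FrohlichSpencerCMP1982, Lemma 2 ii)] -/
def nbhd (adj : B → B → Prop) (S : Finset B) (A : Finset B) : Finset B :=
  S.filter fun b => b ∈ A ∨ ∃ a ∈ A, adj a b

open Classical in
/-- Membership in `nbhd`. [folklore] -/
theorem mem_nbhd {adj : B → B → Prop} {S A : Finset B} {b : B} :
    b ∈ nbhd adj S A ↔ b ∈ S ∧ (b ∈ A ∨ ∃ a ∈ A, adj a b) := by
  simp [nbhd]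

/-- **Connectedness at scale one**: the set of links `A` is connected for the relation `adj`
restricted to `A` (the supports of the densities produced by the expansion are obtained by merging
adjacent supports, hence connected at distance `1`; this is what bounds the hypercube `Ω_ρ` of
FS82 (2.85) by the number of links `L(ρ)`). [cite: FrohlichSpencerCMP1982, §2.10 (2.85) p. 432] -/
def IsAdjConnected (adj : B → B → Prop) (A : Finset B) : Prop :=
  ∀ a ∈ A, ∀ b ∈ A, Relation.ReflTransGen (fun x y => x ∈ A ∧ y ∈ A ∧ adj x y) a b

/-- Singletons are connected. [folklore] -/
theorem isAdjConnected_singleton (adj : B → B → Prop) (a : B) : IsAdjConnected adj {a} := by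
  intro x hx y hy
  rw [Finset.mem_singleton] at hx hy
  subst hx; subst hy
  exact Relation.ReflTransGen.refl

/-- Paths inside `A` are paths inside any `A' ⊇ A`. [folklore] -/
theorem reflTransGen_mono_set {adj : B → B → Prop} {A A' : Finset B} (hAA' : A ⊆ A')
    {a b : B} (h : Relation.ReflTransGen (fun x y => x ∈ A ∧ y ∈ A ∧ adj x y) a b) :
    Relation.ReflTransGen (fun x y => x ∈ A' ∧ y ∈ A' ∧ adj x y) a b :=
  by
  induction h with
  | refl => exact Relation.ReflTransGen.refl
  | tail _ hbc ih => exact ih.tail ⟨hAA' hbc.1, hAA' hbc.2.1, hbc.2.2⟩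

/-- The union of two connected sets joined by an edge is connected (for a symmetric relation).
[folklore] -/
theorem IsAdjConnected.union [DecidableEq B] {adj : B → B → Prop}
    (hadj : ∀ a b, adj a b → adj b a) {A A' : Finset B} (hA : IsAdjConnected adj A)
    (hA' : IsAdjConnected adj A') {a b : B} (ha : a ∈ A) (hb : b ∈ A') (hab : adj a b) :
    IsAdjConnected adj (A ∪ A') := by
  have hab' : Relation.ReflTransGen (fun x y => x ∈ A ∪ A' ∧ y ∈ A ∪ A' ∧ adj x y) a b :=
    Relation.ReflTransGen.single ⟨Finset.mem_union_left _ ha, Finset.mem_union_right _ hb, hab⟩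
  have hba' : Relation.ReflTransGen (fun x y => x ∈ A ∪ A' ∧ y ∈ A ∪ A' ∧ adj x y) b a :=
    Relation.ReflTransGen.single ⟨Finset.mem_union_right _ hb, Finset.mem_union_left _ ha, hadj a b hab⟩
  intro x hx y hy
  rw [Finset.mem_union] at hx hy
  rcases hx with hx | hx <;> rcases hy with hy | hy
  · exact reflTransGen_mono_set Finset.subset_union_left (hA x hx y hy)
  · exact (reflTransGen_mono_set Finset.subset_union_left (hA x hx a ha)).trans
      (hab'.trans (reflTransGen_mono_set Finset.subset_union_right (hA' b hb y hy)))
  · exact (reflTransGen_mono_set Finset.subset_union_right (hA' x hx b hb)).trans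
      (hba'.trans (reflTransGen_mono_set Finset.subset_union_left (hA a ha y hy)))
  · exact reflTransGen_mono_set Finset.subset_union_right (hA' x hx y hy)

/-- The properties of the terms of the expansion: positive weights, 1-ensembles of non-zero
densities supported in `S` with `|ρ_b| = |q_b|`, and the activity bounds
`0 ≤ K(ρ) ≤ 3^{N₁(supp ρ)} ∏_{b∈supp ρ} z_b`. [cite: FrohlichSpencerCMP1982, Lemma 2 i), ii)] -/
structure GoodTerms (adj : B → B → Prop) (S : Finset B) (q : B → ℤ) (z : B → ℝ)
    (L : List (Term B)) : Prop where
  weight_pos : ∀ t ∈ L, 0 < t.weight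
  oneEnsemble : ∀ t ∈ L, IsOneEnsemble adj t.family
  density : ∀ t ∈ L, ∀ ρ ∈ t.family, ρ.support ⊆ S ∧ ρ ≠ 0 ∧ ∀ b ∈ ρ.support, |ρ b| = |q b|
  activity : ∀ t ∈ L, ∀ ρ ∈ t.family,
    0 ≤ t.activity ρ ∧ t.activity ρ ≤ 3 ^ (nbhd adj S ρ.support).card * ∏ b ∈ ρ.support, z b
  connected : ∀ t ∈ L, ∀ ρ ∈ t.family, IsAdjConnected adj ρ.support

/-- Good lists concatenate. [folklore] -/
theorem GoodTerms.append {adj : B → B → Prop} {S : Finset B} {q : B → ℤ} {z : B → ℝ}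
    {L L' : List (Term B)} (h : GoodTerms adj S q z L) (h' : GoodTerms adj S q z L') :
    GoodTerms adj S q z (L ++ L') where
  weight_pos t ht := by
    rcases List.mem_append.1 ht with ht | ht
    exacts [h.weight_pos t ht, h'.weight_pos t ht]
  oneEnsemble t ht := by
    rcases List.mem_append.1 ht with ht | ht
    exacts [h.oneEnsemble t ht, h'.oneEnsemble t ht]
  density t ht := by
    rcases List.mem_append.1 ht with ht | ht
    exacts [h.density t ht, h'.density t ht]
  activity t ht := by
    rcases List.mem_append.1 ht with ht | ht
    exacts [h.activity t ht, h'.activity t ht]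
  connected t ht := by
    rcases List.mem_append.1 ht with ht | ht
    exacts [h.connected t ht, h'.connected t ht]

/-- Rescaling by a positive factor preserves goodness. [folklore] -/
theorem GoodTerms.map_scale {adj : B → B → Prop} {S : Finset B} {q : B → ℤ} {z : B → ℝ}
    {L : List (Term B)} (h : GoodTerms adj S q z L) {a : ℝ} (ha : 0 < a) :
    GoodTerms adj S q z (L.map (Term.scale a)) where
  weight_pos t ht := by
    obtain ⟨t', ht', rfl⟩ := List.mem_map.1 ht
    simpa using mul_pos ha (h.weight_pos t' ht')
  oneEnsemble t ht := by
    obtain ⟨t', ht', rfl⟩ := List.mem_map.1 ht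
    simpa using h.oneEnsemble t' ht'
  density t ht := by
    obtain ⟨t', ht', rfl⟩ := List.mem_map.1 ht
    simpa using h.density t' ht'
  activity t ht := by
    obtain ⟨t', ht', rfl⟩ := List.mem_map.1 ht
    simpa using h.activity t' ht'
  connected t ht := by
    obtain ⟨t', ht', rfl⟩ := List.mem_map.1 ht
    simpa using h.connected t' ht'

/-! ### The identity (2.42) -/

/-- **The pairing identity (2.42) of Fröhlich–Spencer**: a product of two factors is a convex
combination (weights `⅓, ⅓, ⅙, ⅙`) of single factors with tripled activities.
[cite: FrohlichSpencerCMP1982, (2.42) p. 425] -/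
theorem cos_pair_identity (K₁ K₂ a₁ a₂ : ℝ) :
    (1 + K₁ * Real.cos a₁) * (1 + K₂ * Real.cos a₂) =
      1 / 3 * (1 + 3 * K₁ * Real.cos a₁) + 1 / 3 * (1 + 3 * K₂ * Real.cos a₂) +
        1 / 6 * (1 + 3 * K₁ * K₂ * Real.cos (a₁ - a₂)) +
        1 / 6 * (1 + 3 * K₁ * K₂ * Real.cos (a₁ + a₂)) := by
  rw [Real.cos_sub, Real.cos_add]
  ring

/-! ### The bookkeeping invariant of the inductive construction -/

/-- The state of the inductive construction (FS82 pp. 425–426): a family `N` of densities with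
activities `K` and, for each `ρ ∈ N`, a set `W ρ` of "consumed" links with `supp ρ ⊆ W ρ ⊆ S`,
every link of `W ρ` within distance `1` of `supp ρ`, the `W`'s pairwise disjoint, and the activity
bound `3 K(ρ) ≤ 3^{#W(ρ)} ∏_{supp ρ} z` (i.e. `K(ρ) ≤ 3^{n(ρ)} ∏ z` with `n(ρ) + 1 ≤ #W(ρ)`);
every support is connected at distance `1`.
[cite: FrohlichSpencerCMP1982, (2.44)–(2.45)] -/
structure ExpansionState (adj : B → B → Prop) (S : Finset B) (q : B → ℤ) (z : B → ℝ)
    (N : Finset (B →₀ ℤ)) (K : (B →₀ ℤ) → ℝ) (W : (B →₀ ℤ) → Finset B) : Prop where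
  ne_zero : ∀ ρ ∈ N, ρ ≠ 0
  abs_eq : ∀ ρ ∈ N, ∀ b ∈ ρ.support, |ρ b| = |q b|
  support_subset : ∀ ρ ∈ N, ρ.support ⊆ W ρ
  subset_S : ∀ ρ ∈ N, W ρ ⊆ S
  near : ∀ ρ ∈ N, ∀ b ∈ W ρ, b ∈ ρ.support ∨ ∃ a ∈ ρ.support, adj a b
  disjoint : ∀ ρ ∈ N, ∀ ρ' ∈ N, ρ ≠ ρ' → Disjoint (W ρ) (W ρ')
  activity_nonneg : ∀ ρ ∈ N, 0 ≤ K ρ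
  activity_le : ∀ ρ ∈ N, 3 * K ρ ≤ 3 ^ (W ρ).card * ∏ b ∈ ρ.support, z b
  connected : ∀ ρ ∈ N, IsAdjConnected adj ρ.support

namespace ExpansionState

variable {adj : B → B → Prop} {S : Finset B} {q : B → ℤ} {z : B → ℝ}
  {N : Finset (B →₀ ℤ)} {K : (B →₀ ℤ) → ℝ} {W : (B →₀ ℤ) → Finset B}

/-- In a state the supports are pairwise disjoint (an ensemble). [cite: FrohlichSpencerCMP1982, §2.6 p. 424] -/
theorem disjoint_support (h : ExpansionState adj S q z N K W) {ρ ρ' : B →₀ ℤ} (hρ : ρ ∈ N)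
    (hρ' : ρ' ∈ N) (hne : ρ ≠ ρ') : Disjoint ρ.support ρ'.support :=
  (h.disjoint ρ hρ ρ' hρ' hne).mono (h.support_subset ρ hρ) (h.support_subset ρ' hρ')

/-- In a state every density is supported in `S`. [folklore] -/
theorem support_subset_S (h : ExpansionState adj S q z N K W) {ρ : B →₀ ℤ} (hρ : ρ ∈ N) :
    ρ.support ⊆ S :=
  (h.support_subset ρ hρ).trans (h.subset_S ρ hρ)

/-- `∏_{supp ρ} z ≥ 0`. [folklore] -/
theorem prod_nonneg (hz : ∀ b ∈ S, 0 ≤ z b) (h : ExpansionState adj S q z N K W) {ρ : B →₀ ℤ}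
    (hρ : ρ ∈ N) : 0 ≤ ∏ b ∈ ρ.support, z b :=
  Finset.prod_nonneg fun b hb => hz b (h.support_subset_S hρ hb)

/-- `W ρ ⊆ nbhd S (supp ρ)`, whence `#W(ρ) ≤ N₁(supp ρ)`. [cite: FrohlichSpencerCMP1982, p. 425] -/
theorem card_W_le (h : ExpansionState adj S q z N K W) {ρ : B →₀ ℤ} (hρ : ρ ∈ N) :
    (W ρ).card ≤ (nbhd adj S ρ.support).card :=
  Finset.card_le_card fun b hb => mem_nbhd.2 ⟨h.subset_S ρ hρ hb, h.near ρ hρ b hb⟩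

/-- The activity bound ii) of Lemma 2 in a state. [cite: FrohlichSpencerCMP1982, Lemma 2 ii)] -/
theorem activity_le_nbhd (hz : ∀ b ∈ S, 0 ≤ z b) (h : ExpansionState adj S q z N K W)
    {ρ : B →₀ ℤ} (hρ : ρ ∈ N) :
    K ρ ≤ 3 ^ (nbhd adj S ρ.support).card * ∏ b ∈ ρ.support, z b := by
  have h1 := h.activity_le ρ hρ
  have h2 := h.activity_nonneg ρ hρ
  have h3 : (3 : ℝ) ^ (W ρ).card ≤ 3 ^ (nbhd adj S ρ.support).card :=
    pow_le_pow_right₀ (by norm_num) (h.card_W_le hρ)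
  have h4 := h.prod_nonneg hz hρ
  nlinarith [mul_le_mul_of_nonneg_right h3 h4]

/-- Dichotomy: the family of a state is a 1-ensemble, or two distinct members are adjacent.
[cite: FrohlichSpencerCMP1982, p. 425] -/
theorem isOneEnsemble_or_exists_adj (h : ExpansionState adj S q z N K W) :
    IsOneEnsemble adj N ∨
      ∃ ρ₁ ∈ N, ∃ ρ₂ ∈ N, ρ₁ ≠ ρ₂ ∧ ∃ a ∈ ρ₁.support, ∃ b ∈ ρ₂.support, adj a b := by
  by_cases hE : IsOneEnsemble adj N
  · exact Or.inl hE
  · right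
    simp only [IsOneEnsemble, not_forall, exists_prop, not_and, not_not] at hE
    obtain ⟨ρ₁, h₁, ρ₂, h₂, hne, a, ha, b, hb, hab⟩ := hE
    refine ⟨ρ₁, h₁, ρ₂, h₂, hne, a, ha, b, hb, hab ?_⟩
    rintro rfl
    exact Finset.disjoint_left.1 (h.disjoint_support h₁ h₂ hne) ha hb

/-! #### The initial state -/

/-- The initial state: the elementary densities `q_b δ_b`, `b ∈ S`, with activities `z_b` and
`W = supp`. [cite: FrohlichSpencerCMP1982, (2.43)] -/
theorem initial (S : Finset B) (q : B → ℤ) (hq : ∀ b ∈ S, q b ≠ 0) (z : B → ℝ)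
    (hz : ∀ b ∈ S, 0 ≤ z b) [DecidableEq B] :
    ExpansionState adj S q z (S.image fun b => Finsupp.single b (q b))
      (fun ρ => ∏ b ∈ ρ.support, z b) (fun ρ => ρ.support) where
  ne_zero ρ hρ := by
    obtain ⟨b, hb, rfl⟩ := Finset.mem_image.1 hρ
    exact Finsupp.single_ne_zero.2 (hq b hb)
  abs_eq ρ hρ := by
    obtain ⟨b, hb, rfl⟩ := Finset.mem_image.1 hρ
    intro b' hb'
    rw [Finsupp.support_single _ (hq b hb), Finset.mem_singleton] at hb'
    subst hb'
    simp
  support_subset ρ _ := subset_rfl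
  subset_S ρ hρ := by
    obtain ⟨b, hb, rfl⟩ := Finset.mem_image.1 hρ
    rw [Finsupp.support_single _ (hq b hb)]
    exact Finset.singleton_subset_iff.2 hb
  near ρ _ b hb := Or.inl hb
  disjoint ρ hρ ρ' hρ' hne := by
    obtain ⟨b, hb, rfl⟩ := Finset.mem_image.1 hρ
    obtain ⟨b', hb', rfl⟩ := Finset.mem_image.1 hρ'
    rw [Finsupp.support_single _ (hq b hb), Finsupp.support_single _ (hq b' hb'),
      Finset.disjoint_singleton]
    rintro rfl
    exact hne rfl
  activity_nonneg ρ hρ := by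
    obtain ⟨b, hb, rfl⟩ := Finset.mem_image.1 hρ
    exact Finset.prod_nonneg fun b' hb' => by
      rw [Finsupp.support_single _ (hq b hb), Finset.mem_singleton] at hb'
      rw [hb']; exact hz b hb
  activity_le ρ hρ := by
    obtain ⟨b, hb, rfl⟩ := Finset.mem_image.1 hρ
    rw [Finsupp.support_single _ (hq b hb)]
    simp
  connected ρ hρ := by
    obtain ⟨b, hb, rfl⟩ := Finset.mem_image.1 hρ
    rw [Finsupp.support_single _ (hq b hb)]
    exact isAdjConnected_singleton adj b

/-! #### The move "keep `ρ₁`, delete `ρ₂`" (first two terms of (2.42)) -/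

section Keep

variable [DecidableEq B]

/-- Keeping `ρ₁` with tripled activity and deleting its adjacent partner `ρ₂`; the witness link
`b ∈ supp ρ₂` adjacent to `supp ρ₁` is charged to `ρ₁`. [cite: FrohlichSpencerCMP1982, (2.42), (2.45)] -/
theorem keep (h : ExpansionState adj S q z N K W) {ρ₁ ρ₂ : B →₀ ℤ} (h₁ : ρ₁ ∈ N) (h₂ : ρ₂ ∈ N)
    (hne : ρ₁ ≠ ρ₂) {b : B} (hb : b ∈ ρ₂.support) (hadj : ∃ a ∈ ρ₁.support, adj a b) :
    ExpansionState adj S q z (N.erase ρ₂) (Function.update K ρ₁ (3 * K ρ₁))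
      (Function.update W ρ₁ (insert b (W ρ₁))) := by
  have hbW2 : b ∈ W ρ₂ := h.support_subset ρ₂ h₂ hb
  have hbW1 : b ∉ W ρ₁ := fun hb1 =>
    Finset.disjoint_left.1 (h.disjoint ρ₁ h₁ ρ₂ h₂ hne) hb1 hbW2
  have mem_of : ∀ {ρ}, ρ ∈ N.erase ρ₂ → ρ ≠ ρ₂ ∧ ρ ∈ N := fun hρ => Finset.mem_erase.1 hρ
  refine ⟨fun ρ hρ => h.ne_zero ρ (mem_of hρ).2, fun ρ hρ => h.abs_eq ρ (mem_of hρ).2,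
    fun ρ hρ => ?_, fun ρ hρ => ?_, fun ρ hρ => ?_, fun ρ hρ ρ' hρ' hρρ' => ?_, fun ρ hρ => ?_,
    fun ρ hρ => ?_, fun ρ hρ => h.connected ρ (mem_of hρ).2⟩
  · -- support ⊆ W'
    by_cases hρ1 : ρ = ρ₁
    · subst hρ1
      rw [Function.update_self]
      exact (h.support_subset ρ h₁).trans (Finset.subset_insert _ _)
    · rw [Function.update_of_ne hρ1]
      exact h.support_subset ρ (mem_of hρ).2
  · -- W' ⊆ S
    by_cases hρ1 : ρ = ρ₁
    · subst hρ1
      rw [Function.update_self]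
      exact Finset.insert_subset (h.subset_S ρ₂ h₂ hbW2) (h.subset_S ρ h₁)
    · rw [Function.update_of_ne hρ1]
      exact h.subset_S ρ (mem_of hρ).2
  · -- near
    intro b' hb'
    by_cases hρ1 : ρ = ρ₁
    · subst hρ1
      rw [Function.update_self, Finset.mem_insert] at hb'
      rcases hb' with rfl | hb'
      · exact Or.inr hadj
      · exact h.near ρ h₁ b' hb'
    · rw [Function.update_of_ne hρ1] at hb'
      exact h.near ρ (mem_of hρ).2 b' hb'
  · -- disjoint
    have hρN := (mem_of hρ).2
    have hρ'N := (mem_of hρ').2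
    by_cases hρ1 : ρ = ρ₁
    · subst hρ1
      have hρ'1 : ρ' ≠ ρ := fun h' => hρρ' h'.symm
      rw [Function.update_self, Function.update_of_ne hρ'1, Finset.disjoint_insert_left]
      refine ⟨fun hb' => ?_, h.disjoint ρ h₁ ρ' hρ'N hρρ'⟩
      exact Finset.disjoint_left.1 (h.disjoint ρ₂ h₂ ρ' hρ'N (mem_of hρ').1.symm) hbW2 hb'
    · by_cases hρ'1 : ρ' = ρ₁
      · subst hρ'1
        rw [Function.update_self, Function.update_of_ne hρ1, Finset.disjoint_insert_right]
        refine ⟨fun hb' => ?_, h.disjoint ρ hρN ρ' h₁ hρρ'⟩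
        exact Finset.disjoint_left.1 (h.disjoint ρ₂ h₂ ρ hρN (mem_of hρ).1.symm) hbW2 hb'
      · rw [Function.update_of_ne hρ1, Function.update_of_ne hρ'1]
        exact h.disjoint ρ hρN ρ' hρ'N hρρ'
  · -- activity ≥ 0
    by_cases hρ1 : ρ = ρ₁
    · subst hρ1
      rw [Function.update_self]
      have := h.activity_nonneg ρ h₁
      positivity
    · rw [Function.update_of_ne hρ1]
      exact h.activity_nonneg ρ (mem_of hρ).2
  · -- activity bound
    by_cases hρ1 : ρ = ρ₁
    · subst hρ1
      rw [Function.update_self, Function.update_self, Finset.card_insert_of_notMem hbW1, pow_succ]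
      have h1 := h.activity_le ρ h₁
      calc 3 * (3 * K ρ) = (3 * K ρ) * 3 := by ring
        _ ≤ (3 ^ (W ρ).card * ∏ b ∈ ρ.support, z b) * 3 :=
          mul_le_mul_of_nonneg_right h1 (by norm_num)
        _ = 3 ^ (W ρ).card * 3 * ∏ b ∈ ρ.support, z b := by ring
    · rw [Function.update_of_ne hρ1, Function.update_of_ne hρ1]
      exact h.activity_le ρ (mem_of hρ).2

end Keep

/-! #### The move "merge `ρ₁` and `±ρ₂`" (last two terms of (2.42)) -/

section Merge

variable [DecidableEq B]

/-- In a state, the merged density `ρ₁ + σ` (`σ = ±ρ₂`) has support `supp ρ₁ ∪ supp ρ₂`. [folklore] -/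
theorem support_add_eq (h : ExpansionState adj S q z N K W) {ρ₁ ρ₂ σ : B →₀ ℤ} (h₁ : ρ₁ ∈ N)
    (h₂ : ρ₂ ∈ N) (hne : ρ₁ ≠ ρ₂) (hσ : σ.support = ρ₂.support) :
    (ρ₁ + σ).support = ρ₁.support ∪ ρ₂.support := by
  rw [← hσ]
  exact Finsupp.support_add_eq (hσ ▸ h.disjoint_support h₁ h₂ hne)

/-- The merged density is not already a member of the rest of the family. [folklore] -/
theorem add_notMem (h : ExpansionState adj S q z N K W) {ρ₁ ρ₂ σ : B →₀ ℤ} (h₁ : ρ₁ ∈ N)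
    (h₂ : ρ₂ ∈ N) (hne : ρ₁ ≠ ρ₂) (hσ : σ.support = ρ₂.support) :
    ρ₁ + σ ∉ (N.erase ρ₁).erase ρ₂ := by
  intro hmem
  obtain ⟨hρ2, hmem⟩ := Finset.mem_erase.1 hmem
  obtain ⟨hρ1, hρN⟩ := Finset.mem_erase.1 hmem
  have hdisj := h.disjoint_support hρN h₁ hρ1
  rw [h.support_add_eq h₁ h₂ hne hσ] at hdisj
  obtain ⟨a, ha⟩ := Finsupp.support_nonempty_iff.2 (h.ne_zero ρ₁ h₁)
  exact Finset.disjoint_left.1 hdisj (Finset.mem_union_left _ ha) ha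

/-- Merging the adjacent pair `ρ₁, ρ₂` into `ρ₁ + σ`, `σ = ±ρ₂`, with activity `3 K₁ K₂` and
consumed set `W ρ₁ ∪ W ρ₂`. [cite: FrohlichSpencerCMP1982, (2.42), (2.45)] -/
theorem merge (hadj : ∀ a b, adj a b → adj b a) (hz : ∀ b ∈ S, 0 ≤ z b)
    (h : ExpansionState adj S q z N K W) {ρ₁ ρ₂ σ : B →₀ ℤ}
    (h₁ : ρ₁ ∈ N) (h₂ : ρ₂ ∈ N) (hne : ρ₁ ≠ ρ₂) (hab : ∃ a ∈ ρ₁.support, ∃ b ∈ ρ₂.support, adj a b)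
    (hσ : σ.support = ρ₂.support) (hσabs : ∀ b, |σ b| = |ρ₂ b|) :
    ExpansionState adj S q z (insert (ρ₁ + σ) ((N.erase ρ₁).erase ρ₂))
      (Function.update K (ρ₁ + σ) (3 * K ρ₁ * K ρ₂))
      (Function.update W (ρ₁ + σ) (W ρ₁ ∪ W ρ₂)) := by
  set ρ := ρ₁ + σ with hρdef
  set R := (N.erase ρ₁).erase ρ₂ with hR
  have hρR : ρ ∉ R := h.add_notMem h₁ h₂ hne hσ
  have hsupp : ρ.support = ρ₁.support ∪ ρ₂.support := h.support_add_eq h₁ h₂ hne hσ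
  have memR : ∀ {ρ'}, ρ' ∈ R → ρ' ≠ ρ₂ ∧ ρ' ≠ ρ₁ ∧ ρ' ∈ N := fun hρ' => by
    obtain ⟨h2, hρ'⟩ := Finset.mem_erase.1 hρ'
    obtain ⟨h1, hN⟩ := Finset.mem_erase.1 hρ'
    exact ⟨h2, h1, hN⟩
  have neρ : ∀ {ρ'}, ρ' ∈ R → ρ' ≠ ρ := fun hρ' h' => hρR (h' ▸ hρ')
  have cases : ∀ {ρ'}, ρ' ∈ insert ρ R → ρ' = ρ ∨ ρ' ∈ R := fun hρ' => Finset.mem_insert.1 hρ'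
  have hd12 : Disjoint ρ₁.support ρ₂.support := h.disjoint_support h₁ h₂ hne
  refine ⟨fun ρ' hρ' => ?_, fun ρ' hρ' => ?_, fun ρ' hρ' => ?_, fun ρ' hρ' => ?_, fun ρ' hρ' => ?_,
    fun ρ' hρ' ρ'' hρ'' hρρ => ?_, fun ρ' hρ' => ?_, fun ρ' hρ' => ?_, fun ρ' hρ' => ?_⟩
  · -- ne_zero
    rcases cases hρ' with rfl | hρ'
    · rw [← Finsupp.support_nonempty_iff, hsupp]
      exact (Finsupp.support_nonempty_iff.2 (h.ne_zero ρ₁ h₁)).mono Finset.subset_union_left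
    · exact h.ne_zero ρ' (memR hρ').2.2
  · -- abs_eq
    rcases cases hρ' with rfl | hρ'
    · intro b hb
      rw [hsupp, Finset.mem_union] at hb
      change |ρ₁ b + σ b| = |q b|
      rcases hb with hb | hb
      · have hb2 : b ∉ σ.support := hσ ▸ Finset.disjoint_left.1 hd12 hb
        rw [Finsupp.notMem_support_iff.1 hb2, add_zero]
        exact h.abs_eq ρ₁ h₁ b hb
      · have hb1 : b ∉ ρ₁.support := Finset.disjoint_right.1 hd12 hb
        rw [Finsupp.notMem_support_iff.1 hb1, zero_add, hσabs]
        exact h.abs_eq ρ₂ h₂ b hb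
    · exact h.abs_eq ρ' (memR hρ').2.2
  · -- support ⊆ W
    rcases cases hρ' with rfl | hρ'
    · rw [Function.update_self, hsupp]
      exact Finset.union_subset_union (h.support_subset ρ₁ h₁) (h.support_subset ρ₂ h₂)
    · rw [Function.update_of_ne (neρ hρ')]
      exact h.support_subset ρ' (memR hρ').2.2
  · -- W ⊆ S
    rcases cases hρ' with rfl | hρ'
    · rw [Function.update_self]
      exact Finset.union_subset (h.subset_S ρ₁ h₁) (h.subset_S ρ₂ h₂)
    · rw [Function.update_of_ne (neρ hρ')]
      exact h.subset_S ρ' (memR hρ').2.2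
  · -- near
    intro b hb
    rcases cases hρ' with rfl | hρ'
    · rw [Function.update_self, Finset.mem_union] at hb
      rw [hsupp]
      rcases hb with hb | hb
      · rcases h.near ρ₁ h₁ b hb with hb' | ⟨a, ha, hab⟩
        · exact Or.inl (Finset.mem_union_left _ hb')
        · exact Or.inr ⟨a, Finset.mem_union_left _ ha, hab⟩
      · rcases h.near ρ₂ h₂ b hb with hb' | ⟨a, ha, hab⟩
        · exact Or.inl (Finset.mem_union_right _ hb')
        · exact Or.inr ⟨a, Finset.mem_union_right _ ha, hab⟩
    · rw [Function.update_of_ne (neρ hρ')] at hb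
      exact h.near ρ' (memR hρ').2.2 b hb
  · -- disjoint
    rcases cases hρ' with rfl | hρ'
    · have hρ''R : ρ'' ∈ R := by
        rcases cases hρ'' with h'' | h''
        · exact absurd h''.symm hρρ
        · exact h''
      rw [Function.update_self, Function.update_of_ne (neρ hρ''R), Finset.disjoint_union_left]
      exact ⟨h.disjoint ρ₁ h₁ ρ'' (memR hρ''R).2.2 (memR hρ''R).2.1.symm,
        h.disjoint ρ₂ h₂ ρ'' (memR hρ''R).2.2 (memR hρ''R).1.symm⟩
    · rcases cases hρ'' with rfl | hρ''
      · rw [Function.update_self, Function.update_of_ne (neρ hρ'), Finset.disjoint_union_right]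
        exact ⟨h.disjoint ρ' (memR hρ').2.2 ρ₁ h₁ (memR hρ').2.1,
          h.disjoint ρ' (memR hρ').2.2 ρ₂ h₂ (memR hρ').1⟩
      · rw [Function.update_of_ne (neρ hρ'), Function.update_of_ne (neρ hρ'')]
        exact h.disjoint ρ' (memR hρ').2.2 ρ'' (memR hρ'').2.2 hρρ
  · -- activity ≥ 0
    rcases cases hρ' with rfl | hρ'
    · rw [Function.update_self]
      have := h.activity_nonneg ρ₁ h₁
      have := h.activity_nonneg ρ₂ h₂
      positivity
    · rw [Function.update_of_ne (neρ hρ')]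
      exact h.activity_nonneg ρ' (memR hρ').2.2
  · -- activity bound
    rcases cases hρ' with rfl | hρ'
    · rw [Function.update_self, Function.update_self, hsupp,
        Finset.card_union_of_disjoint (h.disjoint ρ₁ h₁ ρ₂ h₂ hne), pow_add,
        Finset.prod_union hd12]
      have e1 := h.activity_le ρ₁ h₁
      have e2 := h.activity_le ρ₂ h₂
      have n1 : 0 ≤ 3 * K ρ₁ := by have := h.activity_nonneg ρ₁ h₁; positivity
      have n2 : 0 ≤ 3 * K ρ₂ := by have := h.activity_nonneg ρ₂ h₂; positivity
      have p1 := h.prod_nonneg hz h₁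
      calc 3 * (3 * K ρ₁ * K ρ₂) = (3 * K ρ₁) * (3 * K ρ₂) := by ring
        _ ≤ (3 ^ (W ρ₁).card * ∏ b ∈ ρ₁.support, z b) * (3 ^ (W ρ₂).card * ∏ b ∈ ρ₂.support, z b) :=
          mul_le_mul e1 e2 n2 (by positivity)
        _ = 3 ^ (W ρ₁).card * 3 ^ (W ρ₂).card *
              ((∏ b ∈ ρ₁.support, z b) * ∏ b ∈ ρ₂.support, z b) := by ring
    · rw [Function.update_of_ne (neρ hρ'), Function.update_of_ne (neρ hρ')]
      exact h.activity_le ρ' (memR hρ').2.2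
  · -- connected
    rcases cases hρ' with rfl | hρ'
    · rw [hsupp]
      obtain ⟨a, ha, b, hb, hab⟩ := hab
      exact (h.connected ρ₁ h₁).union hadj (h.connected ρ₂ h₂) ha hb hab
    · exact h.connected ρ' (memR hρ').2.2

end Merge

end ExpansionState

/-! ### Factor products under the moves -/

section Products

variable [DecidableEq B]

/-- The factor product of `insert ρ N`. [folklore] -/
theorem ensembleProd_insert {N : Finset (B →₀ ℤ)} {ρ : B →₀ ℤ} (hρ : ρ ∉ N) (K : (B →₀ ℤ) → ℝ)
    (α : B → ℝ) :
    ensembleProd (insert ρ N) K α = (1 + K ρ * Real.cos (phase ρ α)) * ensembleProd N K α := by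
  unfold ensembleProd
  rw [Finset.prod_insert hρ]

omit [DecidableEq B] in
/-- The factor product only depends on the activities on the family. [folklore] -/
theorem ensembleProd_congr {N : Finset (B →₀ ℤ)} {K K' : (B →₀ ℤ) → ℝ} (hK : ∀ ρ ∈ N, K ρ = K' ρ)
    (α : B → ℝ) : ensembleProd N K α = ensembleProd N K' α :=
  Finset.prod_congr rfl fun ρ hρ => by rw [hK ρ hρ]

/-- Updating the activity of a non-member does not change the factor product. [folklore] -/
theorem ensembleProd_update_of_notMem {N : Finset (B →₀ ℤ)} {ρ : B →₀ ℤ} (hρ : ρ ∉ N)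
    (K : (B →₀ ℤ) → ℝ) (x : ℝ) (α : B → ℝ) :
    ensembleProd N (Function.update K ρ x) α = ensembleProd N K α :=
  ensembleProd_congr (fun _ hρ' => Function.update_of_ne (ne_of_mem_of_not_mem hρ' hρ) _ _) α

/-- Splitting off two distinct members of the family. [folklore] -/
theorem ensembleProd_eq_mul_mul {N : Finset (B →₀ ℤ)} {ρ₁ ρ₂ : B →₀ ℤ} (h₁ : ρ₁ ∈ N)
    (h₂ : ρ₂ ∈ N) (hne : ρ₁ ≠ ρ₂) (K : (B →₀ ℤ) → ℝ) (α : B → ℝ) :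
    ensembleProd N K α = (1 + K ρ₁ * Real.cos (phase ρ₁ α)) *
      ((1 + K ρ₂ * Real.cos (phase ρ₂ α)) * ensembleProd ((N.erase ρ₁).erase ρ₂) K α) := by
  unfold ensembleProd
  rw [← Finset.mul_prod_erase N _ h₁,
    ← Finset.mul_prod_erase (N.erase ρ₁) _ (Finset.mem_erase.2 ⟨hne.symm, h₂⟩)]

/-- `N ∖ {ρ₂} = {ρ₁} ∪ (N ∖ {ρ₁, ρ₂})`. [folklore] -/
theorem erase_eq_insert_erase_erase {N : Finset (B →₀ ℤ)} {ρ₁ ρ₂ : B →₀ ℤ} (h₁ : ρ₁ ∈ N)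
    (hne : ρ₁ ≠ ρ₂) : N.erase ρ₂ = insert ρ₁ ((N.erase ρ₁).erase ρ₂) := by
  rw [Finset.erase_right_comm, Finset.insert_erase (Finset.mem_erase.2 ⟨hne, h₁⟩)]

/-- `N ∖ {ρ₁} = {ρ₂} ∪ (N ∖ {ρ₁, ρ₂})`. [folklore] -/
theorem erase_eq_insert_erase_erase' {N : Finset (B →₀ ℤ)} {ρ₁ ρ₂ : B →₀ ℤ} (h₂ : ρ₂ ∈ N)
    (hne : ρ₁ ≠ ρ₂) : N.erase ρ₁ = insert ρ₂ ((N.erase ρ₁).erase ρ₂) := by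
  rw [Finset.insert_erase (Finset.mem_erase.2 ⟨hne.symm, h₂⟩)]

/-- The product after the move "keep `ρ₁`, delete `ρ₂`". [cite: FrohlichSpencerCMP1982, (2.42)] -/
theorem ensembleProd_keep {N : Finset (B →₀ ℤ)} {ρ₁ ρ₂ : B →₀ ℤ} (h₁ : ρ₁ ∈ N)
    (hne : ρ₁ ≠ ρ₂) (K : (B →₀ ℤ) → ℝ) (α : B → ℝ) :
    ensembleProd (N.erase ρ₂) (Function.update K ρ₁ (3 * K ρ₁)) α =
      (1 + 3 * K ρ₁ * Real.cos (phase ρ₁ α)) * ensembleProd ((N.erase ρ₁).erase ρ₂) K α := by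
  have hρ₁ : ρ₁ ∉ (N.erase ρ₁).erase ρ₂ := fun h =>
    (Finset.mem_erase.1 (Finset.mem_erase.1 h).2).1 rfl
  rw [erase_eq_insert_erase_erase h₁ hne, ensembleProd_insert hρ₁, Function.update_self,
    ensembleProd_update_of_notMem hρ₁, mul_assoc]

/-- The product after the move "keep `ρ₂`, delete `ρ₁`". [cite: FrohlichSpencerCMP1982, (2.42)] -/
theorem ensembleProd_keep' {N : Finset (B →₀ ℤ)} {ρ₁ ρ₂ : B →₀ ℤ} (h₂ : ρ₂ ∈ N)
    (hne : ρ₁ ≠ ρ₂) (K : (B →₀ ℤ) → ℝ) (α : B → ℝ) :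
    ensembleProd (N.erase ρ₁) (Function.update K ρ₂ (3 * K ρ₂)) α =
      (1 + 3 * K ρ₂ * Real.cos (phase ρ₂ α)) * ensembleProd ((N.erase ρ₁).erase ρ₂) K α := by
  have hρ₂ : ρ₂ ∉ (N.erase ρ₁).erase ρ₂ := fun h => (Finset.mem_erase.1 h).1 rfl
  conv_lhs => rw [erase_eq_insert_erase_erase' h₂ hne]
  rw [ensembleProd_insert hρ₂, Function.update_self, ensembleProd_update_of_notMem hρ₂, mul_assoc]

/-- The product after the move "merge into `ρ₁ + σ`". [cite: FrohlichSpencerCMP1982, (2.42)] -/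
theorem ensembleProd_merge {N : Finset (B →₀ ℤ)} {ρ₁ ρ₂ σ : B →₀ ℤ}
    (hρ : ρ₁ + σ ∉ (N.erase ρ₁).erase ρ₂) (K : (B →₀ ℤ) → ℝ) (α : B → ℝ) :
    ensembleProd (insert (ρ₁ + σ) ((N.erase ρ₁).erase ρ₂))
        (Function.update K (ρ₁ + σ) (3 * K ρ₁ * K ρ₂)) α =
      (1 + 3 * K ρ₁ * K ρ₂ * Real.cos (phase ρ₁ α + phase σ α)) *
        ensembleProd ((N.erase ρ₁).erase ρ₂) K α := by
  rw [ensembleProd_insert hρ, Function.update_self, ensembleProd_update_of_notMem hρ, phase_add]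

end Products

/-! ### The expansion theorem -/

section Main

variable [DecidableEq B]

/-- The inductive construction of FS82 pp. 425–426: every state expands, with total weight one,
into good terms. Induction on the number of factors. [cite: FrohlichSpencerCMP1982, Lemma 2, proof pp. 425–426] -/
theorem ExpansionState.exists_expansion {adj : B → B → Prop} (hadj : ∀ a b, adj a b → adj b a) {S : Finset B}
    {q : B → ℤ} {z : B → ℝ} (hz : ∀ b ∈ S, 0 ≤ z b) :
    ∀ (n : ℕ) {N : Finset (B →₀ ℤ)} {K : (B →₀ ℤ) → ℝ} {W : (B →₀ ℤ) → Finset B},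
      N.card = n → ExpansionState adj S q z N K W →
        ∃ L : List (Term B), GoodTerms adj S q z L ∧ weightSum L = 1 ∧
          ∀ α : B → ℝ, ensembleProd N K α = evalSum L α := by
  intro n
  induction n with
  | zero =>
    intro N K W hcard h
    rw [Finset.card_eq_zero] at hcard
    subst hcard
    refine ⟨[⟨1, ∅, K⟩], ⟨?_, ?_, ?_, ?_, ?_⟩, by simp [weightSum], fun α => ?_⟩
    · intro t ht; simp only [List.mem_singleton] at ht; subst ht; norm_num
    · intro t ht; simp only [List.mem_singleton] at ht; subst ht
      intro ρ hρ; simp at hρ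
    · intro t ht; simp only [List.mem_singleton] at ht; subst ht
      intro ρ hρ; simp at hρ
    · intro t ht; simp only [List.mem_singleton] at ht; subst ht
      intro ρ hρ; simp at hρ
    · intro t ht; simp only [List.mem_singleton] at ht; subst ht
      intro ρ hρ; simp at hρ
    · simp [evalSum, Term.eval]
  | succ n ih =>
    intro N K W hcard h
    rcases h.isOneEnsemble_or_exists_adj with hE | ⟨ρ₁, h₁, ρ₂, h₂, hne, a, ha, b, hb, hab⟩
    · -- terminal: a single term
      refine ⟨[⟨1, N, K⟩], ⟨?_, ?_, ?_, ?_, ?_⟩, by simp [weightSum], fun α => ?_⟩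
      · intro t ht; simp only [List.mem_singleton] at ht; subst ht; norm_num
      · intro t ht; simp only [List.mem_singleton] at ht; subst ht; exact hE
      · intro t ht; simp only [List.mem_singleton] at ht; subst ht
        intro ρ hρ
        exact ⟨h.support_subset_S hρ, h.ne_zero ρ hρ, h.abs_eq ρ hρ⟩
      · intro t ht; simp only [List.mem_singleton] at ht; subst ht
        intro ρ hρ
        exact ⟨h.activity_nonneg ρ hρ, h.activity_le_nbhd hz hρ⟩
      · intro t ht; simp only [List.mem_singleton] at ht; subst ht
        intro ρ hρ
        exact h.connected ρ hρ
      · simp [evalSum, Term.eval]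
    · -- one application of (2.42) to the adjacent pair `ρ₁, ρ₂`, then the induction hypothesis
      have hc2 : (N.erase ρ₂).card = n := by rw [Finset.card_erase_of_mem h₂, hcard]; rfl
      have hc1 : (N.erase ρ₁).card = n := by rw [Finset.card_erase_of_mem h₁, hcard]; rfl
      have hcR : ∀ {σ : B →₀ ℤ}, σ.support = ρ₂.support →
          (insert (ρ₁ + σ) ((N.erase ρ₁).erase ρ₂)).card = n := fun {σ} hσ => by
        rw [Finset.card_insert_of_notMem (h.add_notMem h₁ h₂ hne hσ),
          Finset.card_erase_of_mem (Finset.mem_erase.2 ⟨hne.symm, h₂⟩), hc1]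
        rcases n with _ | n
        · exact absurd hc1 (Finset.card_ne_zero_of_mem (Finset.mem_erase.2 ⟨hne.symm, h₂⟩))
        · rfl
      -- the four new states
      have s1 := h.keep h₁ h₂ hne hb ⟨a, ha, hab⟩
      have s2 := h.keep h₂ h₁ hne.symm ha ⟨b, hb, hadj a b hab⟩
      have hσp : (ρ₂ : B →₀ ℤ).support = ρ₂.support := rfl
      have hσm : (-ρ₂ : B →₀ ℤ).support = ρ₂.support := Finsupp.support_neg ρ₂
      have s3 := h.merge hadj hz h₁ h₂ hne ⟨a, ha, b, hb, hab⟩ hσm (fun b => by simp)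
      have s4 := h.merge hadj hz h₁ h₂ hne ⟨a, ha, b, hb, hab⟩ hσp (fun b => rfl)
      obtain ⟨L₁, g₁, w₁, e₁⟩ := ih hc2 s1
      obtain ⟨L₂, g₂, w₂, e₂⟩ := ih hc1 s2
      obtain ⟨L₃, g₃, w₃, e₃⟩ := ih (hcR hσm) s3
      obtain ⟨L₄, g₄, w₄, e₄⟩ := ih (hcR hσp) s4
      refine ⟨L₁.map (Term.scale (1 / 3)) ++ L₂.map (Term.scale (1 / 3)) ++
          L₃.map (Term.scale (1 / 6)) ++ L₄.map (Term.scale (1 / 6)), ?_, ?_, fun α => ?_⟩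
      · exact (((g₁.map_scale (by norm_num)).append (g₂.map_scale (by norm_num))).append
          (g₃.map_scale (by norm_num))).append (g₄.map_scale (by norm_num))
      · simp only [weightSum_append, weightSum_map_scale, w₁, w₂, w₃, w₄]
        norm_num
      · simp only [evalSum_append, evalSum_map_scale, ← e₁, ← e₂, ← e₃, ← e₄]
        rw [ensembleProd_keep h₁ hne, ensembleProd_keep' h₂ hne,
          ensembleProd_merge (h.add_notMem h₁ h₂ hne hσm),
          ensembleProd_merge (h.add_notMem h₁ h₂ hne hσp), phase_neg,
          ensembleProd_eq_mul_mul h₁ h₂ hne K α, ← mul_assoc, cos_pair_identity,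
          ← sub_eq_add_neg]
        ring

/-- **Fröhlich–Spencer 1982, Lemma 2 (expansion into 1-ensembles).** Let `S` be a finite set of
links, `adj` a symmetric relation on links ("distance `≤ 1`"), `q_b ≠ 0` integers and `z_b ≥ 0`
activities (`b ∈ S`). Then there is a finite list of terms `(c_γ, 𝒩_γ, K_γ)` with `c_γ > 0`,
`∑_γ c_γ = 1`, each `𝒩_γ` a 1-ensemble of non-zero current densities `ρ` supported in `S` with
`|ρ_b| = |q_b|` on `supp ρ` and `supp ρ` connected at distance `1`, activities
`0 ≤ K_γ(ρ) ≤ 3^{N₁(supp ρ)} ∏_{b ∈ supp ρ} z_b` (`N₁(A) = #(nbhd adj S A)`, the number of links of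
`S` within distance `1` of `A`), such that for every field `α`,
`∏_{b ∈ S} (1 + z_b cos(q_b α_b)) = ∑_γ c_γ ∏_{ρ ∈ 𝒩_γ} (1 + K_γ(ρ) cos(α(ρ)))`.
(In FS82 the activities are `z_b = z_{|q_b|}`, so that `∏_{b∈supp ρ} z_b = ∏_{xy ⊂ supp ρ} z_{|ρ_{xy}|}`
as printed in ii).) [cite: FrohlichSpencerCMP1982, §2.6 Lemma 2, (2.41), pp. 424–426] -/
theorem exists_oneEnsemble_expansion (adj : B → B → Prop) (hadj : ∀ a b, adj a b → adj b a) (S : Finset B)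
    (q : B → ℤ) (hq : ∀ b ∈ S, q b ≠ 0) (z : B → ℝ) (hz : ∀ b ∈ S, 0 ≤ z b) :
    ∃ L : List (Term B),
      (∀ t ∈ L, 0 < t.weight) ∧ weightSum L = 1 ∧
      (∀ t ∈ L, IsOneEnsemble adj t.family) ∧
      (∀ t ∈ L, ∀ ρ ∈ t.family, ρ.support ⊆ S ∧ ρ ≠ 0 ∧ ∀ b ∈ ρ.support, |ρ b| = |q b|) ∧
      (∀ t ∈ L, ∀ ρ ∈ t.family, 0 ≤ t.activity ρ ∧
        t.activity ρ ≤ 3 ^ (nbhd adj S ρ.support).card * ∏ b ∈ ρ.support, z b) ∧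
      (∀ t ∈ L, ∀ ρ ∈ t.family, IsAdjConnected adj ρ.support) ∧
      ∀ α : B → ℝ, ∏ b ∈ S, (1 + z b * Real.cos (q b * α b)) = evalSum L α := by
  obtain ⟨L, g, w, e⟩ := ExpansionState.exists_expansion hadj hz _ rfl
    (ExpansionState.initial (adj := adj) S q hq z hz)
  refine ⟨L, g.weight_pos, w, g.oneEnsemble, g.density, g.activity, g.connected, fun α => ?_⟩
  rw [← e α]
  unfold ensembleProd
  rw [Finset.prod_image]
  · refine Finset.prod_congr rfl fun b hb => ?_
    dsimp only
    rw [Finsupp.support_single _ (hq b hb), Finset.prod_singleton, phase_single]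
  · intro b hb b' hb' hbb'
    by_contra hne
    have := congrArg (fun ρ : B →₀ ℤ => ρ b) hbb'
    dsimp only at this
    rw [Finsupp.single_eq_same, Finsupp.single_apply, if_neg (Ne.symm hne)] at this
    exact hq b hb this

end Main

end EnsembleExpansion

end Literature.Probability.LatticeModels
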